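import Literature.IUT.LogVolume.TensorPacketContentSharp
import Literature.IUT.LogVolume.DifferentEstimatesCorollaries
import Mathlib.FieldTheory.Normal.Basic
import HarnessLib

/-!
# The differents `d_{L_J}` of the factor fields of a tensor packet: monotonicity, Lenstra's bound, and their
# EVALUATION for packets of one normal field ([IUTchIV] Prop. 1.1, 1.3; Serre, Corps locaux III §4)

abc-iut cell, seat abc-iut-w6-d018 (sequel to `TensorPacketDifferentSharp`/`TensorPacketContentSharp`, R2 TARGET #1
«Rest_lower»). There the sharp lower end of the (Ind2)-orbit-hull volume of a packet `V = ⊗_{ℚ_p} k_i ≅ ∏_J L_J`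
carries the term `d_I − d_{L_J}` — the packet's different `d_I = Σ d_i` against the different `d_{L_J}` of a factor
field, left as a term. HERE `d_{L_J}` is bracketed and, for packets of ONE normal field, evaluated:

* `differentOrd_le_of_isometry` — an isometric `ℚ_p`-algebra map of fields `k₀ → L` gives `d_{k₀} ≤ d_L`
  ([IUTchIV] Prop. 1.3 (i), the tree's `differentOrd_base_le`, with the normed-algebra structure through the map);
  `differentOrd_eq_of_isometry_of_surjective` — equality when the map is onto;
* `differentOrd_le_differentOrd_dFac` — **`d_i ≤ d_{L_J}`** for every slot `i` and factor `J` (the component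
  embeddings `σ_{iJ} : k_i → L_J` are isometries); `differentOrd_dFac_lt` — **Lenstra's bound**
  `d_{L_J} < d_i + 1/e_i + v_p([L_J : k_i])` (the tree's `differentOrd_lt`);
* `mem_fieldRange_factorEmb_of_forall` — `L_J` is generated by the images `σ_{iJ}(k_i)`: if one intermediate field
  contains them all, it is everything (`ψ` is onto and `V` is spanned by pure tensors);
* **`factorEmb_surjective_of_normal`** / **`differentOrd_dFac_eq_of_normal`** — if every `k_i` is `ℚ_p`-isomorphic to
  ONE normal extension `k_{i₀}/ℚ_p`, then every `σ_{iJ}` is onto (two embeddings of a normal extension into a field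
  have the same image, Mathlib `AlgHom.fieldRange_of_normal`), so **`d_{L_J} = d_{i₀}` for every `J`** and the sharp
  different gain of `TensorPacketContentSharp` is `d_I − d_{i₀} = (|I| − 1)·d_{i₀}` per collection
  (`dSum_sub_differentOrd_dFac_eq_of_normal`) — the case of the capsules `⊗^{j+1} K_{v̲}` of [IUTchIII] Cor. 3.12 at a
  prime where the completions of `K` are Galois-conjugate.
Classical (Serre, Corps locaux III §4 Prop. 8; Lenstra); the tags record the cell's typing of [IUTchIV] §1.
[cite: Mochizuki2012, IUTchIV Prop. 1.1 p. 9, Prop. 1.3 p. 11–12] No side taken on [IUTchIII] Cor. 3.12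
[claim: Mochizuki2012, status: disputed]. PROOF-ONLY file: no definitions, no instances, no named `Prop` facts
(normed-algebra structures through the embeddings are built locally inside the proofs).
-/

noncomputable section

open Set Module Function
open scoped TensorProduct NormedField

namespace Literature.IUT.LogVolume

/-! ## Isometric embeddings of fields and the order of the different -/

section Isometry

variable (p : ℕ) [Fact p.Prime]
variable {k₀ : Type} [NontriviallyNormedField k₀] [NormedAlgebra ℚ_[p] k₀] [IsUltrametricDist k₀] [ProperSpace k₀]
variable {L : Type} [NontriviallyNormedField L] [NormedAlgebra ℚ_[p] L] [IsUltrametricDist L] [ProperSpace L]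

/-- **`d_{k₀} ≤ d_L` along an isometric `ℚ_p`-embedding `φ : k₀ → L`** ([IUTchIV] Prop. 1.3 (i) / the tree's
`differentOrd_base_le`, for the normed `k₀`-algebra structure of `L` through `φ`, built locally).
[cite: Mochizuki2012, IUTchIV Prop. 1.3 (i) p. 11] -/
theorem differentOrd_le_of_isometry (φ : k₀ →ₐ[ℚ_[p]] L) (hφ : ∀ x, ‖φ x‖ = ‖x‖) :
    differentOrd p k₀ ≤ differentOrd p L := by
  letI : Algebra k₀ L := φ.toRingHom.toAlgebra
  have halg : ∀ a : k₀, algebraMap k₀ L a = φ a := fun _ => rfl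
  letI : NormedAlgebra k₀ L :=
    { φ.toRingHom.toAlgebra with
      norm_smul_le := fun r x => by
        rw [Algebra.smul_def, halg, norm_mul, hφ] }
  haveI : IsScalarTower ℚ_[p] k₀ L := IsScalarTower.of_algebraMap_eq fun c => by
    rw [halg, AlgHom.commutes]
  exact differentOrd_base_le p k₀ L

/-- **Lenstra's bound along an isometric embedding**: `d_L < d_{k₀} + 1/e_{k₀} + v_p([L : k₀])` (the tree's
`differentOrd_lt`, structure through `φ`). [cite: Mochizuki2012, IUTchIV Prop. 1.3 (ii) p. 11] -/
theorem differentOrd_lt_of_isometry (φ : k₀ →ₐ[ℚ_[p]] L) (hφ : ∀ x, ‖φ x‖ = ‖x‖) :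
    letI : Algebra k₀ L := φ.toRingHom.toAlgebra
    differentOrd p L < differentOrd p k₀ + 1 / (absRamificationIdx p k₀ : ℝ) +
      padicValNat p (Module.finrank k₀ L) := by
  letI : Algebra k₀ L := φ.toRingHom.toAlgebra
  have halg : ∀ a : k₀, algebraMap k₀ L a = φ a := fun _ => rfl
  letI : NormedAlgebra k₀ L :=
    { φ.toRingHom.toAlgebra with
      norm_smul_le := fun r x => by
        rw [Algebra.smul_def, halg, norm_mul, hφ] }
  haveI : IsScalarTower ℚ_[p] k₀ L := IsScalarTower.of_algebraMap_eq fun c => by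
    rw [halg, AlgHom.commutes]
  exact differentOrd_lt p k₀ L

/-- **Equality for an isometric ISOMORPHISM**: if `φ : k₀ → L` is an isometric `ℚ_p`-algebra map onto `L`, then
`d_{k₀} = d_L` (both inequalities, through `φ` and `φ⁻¹`). [cite: Mochizuki2012, IUTchIV Prop. 1.3 (i) p. 11] -/
theorem differentOrd_eq_of_isometry_of_surjective (φ : k₀ →ₐ[ℚ_[p]] L) (hφ : ∀ x, ‖φ x‖ = ‖x‖)
    (hsurj : Function.Surjective φ) : differentOrd p k₀ = differentOrd p L := by
  refine le_antisymm (differentOrd_le_of_isometry p φ hφ) ?_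
  let e : k₀ ≃ₐ[ℚ_[p]] L := AlgEquiv.ofBijective φ ⟨φ.toRingHom.injective, hsurj⟩
  refine differentOrd_le_of_isometry p (e.symm : L →ₐ[ℚ_[p]] k₀) fun y => ?_
  obtain ⟨x, rfl⟩ := hsurj y
  have hx : e.symm (φ x) = x := e.symm_apply_apply x
  show ‖e.symm (φ x)‖ = ‖φ x‖
  rw [hx, hφ]

end Isometry

/-! ## The factor fields of a packet -/

section Factors

variable (p : ℕ) [Fact p.Prime]
variable {I : Type} [Fintype I] [DecidableEq I]
variable (k : I → Type) [∀ i, NontriviallyNormedField (k i)] [∀ i, NormedAlgebra ℚ_[p] (k i)]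
  [∀ i, IsUltrametricDist (k i)] [∀ i, ProperSpace (k i)]

/-- **`d_i ≤ d_{L_J}`** for every slot `i` and factor `J` of `V ≅ ∏_J L_J` (the component embedding `k_i → L_J` is an
isometry). Hence the sharp different gain `d_I − d_{L_J}` of `TensorPacketContentSharp` is at most `d_I − max_i d_i`.
[cite: Mochizuki2012, IUTchIV Prop. 1.1 p. 9, Prop. 1.3 (i) p. 11] -/
theorem differentOrd_le_differentOrd_dFac (i : I) (J : DIdx p k) :
    differentOrd p (k i) ≤ differentOrd p (DFac p k J) :=
  differentOrd_le_of_isometry p (factorEmb p k (DFac p k) (dEquiv p k) i J) (norm_factorEmb p k (DFac p k) (dEquiv p k) i J)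

/-- **Lenstra's bound for a factor field**: `d_{L_J} < d_i + 1/e_i + v_p([L_J : k_i])` for every slot `i` (`L_J` a
`k_i`-algebra through the component embedding). [cite: Mochizuki2012, IUTchIV Prop. 1.3 (ii) p. 11] -/
theorem differentOrd_dFac_lt (i : I) (J : DIdx p k) :
    letI : Algebra (k i) (DFac p k J) := (factorEmb p k (DFac p k) (dEquiv p k) i J).toRingHom.toAlgebra
    differentOrd p (DFac p k J) < differentOrd p (k i) + 1 / (absRamificationIdx p (k i) : ℝ) +
      padicValNat p (Module.finrank (k i) (DFac p k J)) :=
  differentOrd_lt_of_isometry p (factorEmb p k (DFac p k) (dEquiv p k) i J) (norm_factorEmb p k (DFac p k) (dEquiv p k) i J)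

omit [∀ i, IsUltrametricDist (k i)] in
/-- **`L_J` is generated by the images of the slots**: an intermediate field of `L_J/ℚ_p` containing every
`σ_{iJ}(k_i)` is all of `L_J` (`ψ : V → ∏ L_J` is onto and `V` is spanned by the pure tensors, whose `J`-components
are products `∏_i σ_{iJ}(x_i)`). [cite: Mochizuki2012, IUTchIV Prop. 1.4 (i) p. 13] -/
theorem mem_of_forall_range_factorEmb_subset (J : DIdx p k) (E : IntermediateField ℚ_[p] (DFac p k J))
    (hE : ∀ i, Set.range (factorEmb p k (DFac p k) (dEquiv p k) i J) ⊆ E) (x : DFac p k J) : x ∈ E := by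
  classical
  obtain ⟨v, hv⟩ : ∃ v : PacketAlgebra p k, dEquiv p k v J = x :=
    ⟨(dEquiv p k).symm (Pi.single J x), by rw [AlgEquiv.apply_symm_apply, Pi.single_eq_same]⟩
  rw [← hv]
  clear hv
  induction v using PiTensorProduct.induction_on with
  | smul_tprod r f =>
    rw [map_smul, Pi.smul_apply]
    refine E.smul_mem ?_
    have h : dEquiv p k (PiTensorProduct.tprod ℚ_[p] f) J = ∏ i, factorEmb p k (DFac p k) (dEquiv p k) i J (f i) :=
      psi_purePacket_apply p k (DFac p k) (dEquiv p k) f J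
    rw [h]
    exact prod_mem fun i _ => hE i ⟨f i, rfl⟩
  | add a b ha hb =>
    rw [map_add, Pi.add_apply]
    exact add_mem ha hb

omit [∀ i, IsUltrametricDist (k i)] in
/-- **Packets of ONE normal field: every component embedding is onto.** If every `k_i` is `ℚ_p`-isomorphic to
`k_{i₀}` and `k_{i₀}/ℚ_p` is normal, then `σ_{i₀J} : k_{i₀} → L_J` is surjective for every `J` (all the images
`σ_{iJ}(k_i)` are images of the normal `k_{i₀}` in the field `L_J`, hence ONE intermediate field — Mathlib
`AlgHom.fieldRange_of_normal` — which generates `L_J`). [cite: Mochizuki2012, IUTchIV Prop. 1.4 (i) p. 13] -/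
theorem factorEmb_surjective_of_normal (i₀ : I) [Normal ℚ_[p] (k i₀)] (τ : ∀ i, k i₀ ≃ₐ[ℚ_[p]] k i)
    (J : DIdx p k) : Function.Surjective (factorEmb p k (DFac p k) (dEquiv p k) i₀ J) := by
  set f₀ := factorEmb p k (DFac p k) (dEquiv p k) i₀ J with hf₀
  -- the image of `k_{i₀}` as an intermediate field, normal over `ℚ_p`
  let E : IntermediateField ℚ_[p] (DFac p k J) := f₀.fieldRange
  let e : k i₀ ≃ₐ[ℚ_[p]] E :=
    (AlgEquiv.ofInjectiveField f₀).trans (Subalgebra.equivOfEq _ _ f₀.fieldRange_toSubalgebra.symm)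
  haveI : Normal ℚ_[p] E := Normal.of_algEquiv e
  -- every slot's image lies in `E`
  have hE : ∀ i, Set.range (factorEmb p k (DFac p k) (dEquiv p k) i J) ⊆ (E : Set (DFac p k J)) := by
    intro i
    rintro _ ⟨x, rfl⟩
    let g : E →ₐ[ℚ_[p]] DFac p k J :=
      ((factorEmb p k (DFac p k) (dEquiv p k) i J).comp (τ i : k i₀ →ₐ[ℚ_[p]] k i)).comp
        (e.symm : E →ₐ[ℚ_[p]] k i₀)
    have hg : g.fieldRange = E := AlgHom.fieldRange_of_normal g
    have hx : factorEmb p k (DFac p k) (dEquiv p k) i J x = g (e ((τ i).symm x)) := by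
      show _ = factorEmb p k (DFac p k) (dEquiv p k) i J (τ i (e.symm (e ((τ i).symm x))))
      rw [AlgEquiv.symm_apply_apply, AlgEquiv.apply_symm_apply]
    rw [hx]
    have hmem : g (e ((τ i).symm x)) ∈ g.fieldRange := g.mem_fieldRange_self _
    rw [hg] at hmem
    exact hmem
  -- hence `E` is everything
  intro y
  have hy : y ∈ E := mem_of_forall_range_factorEmb_subset p k J E hE y
  obtain ⟨x, hx⟩ := (AlgHom.mem_fieldRange (f := f₀)).mp hy
  exact ⟨x, hx⟩

/-- **Packets of ONE normal field: `d_{L_J} = d_{i₀}` for every factor.** [cite: Mochizuki2012, IUTchIV Prop. 1.3 (i) p. 11] -/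
theorem differentOrd_dFac_eq_of_normal (i₀ : I) [Normal ℚ_[p] (k i₀)] (τ : ∀ i, k i₀ ≃ₐ[ℚ_[p]] k i)
    (J : DIdx p k) : differentOrd p (DFac p k J) = differentOrd p (k i₀) :=
  (differentOrd_eq_of_isometry_of_surjective p (factorEmb p k (DFac p k) (dEquiv p k) i₀ J)
    (norm_factorEmb p k (DFac p k) (dEquiv p k) i₀ J) (factorEmb_surjective_of_normal p k i₀ τ J)).symm

omit [Fintype I] [DecidableEq I] in
/-- Isomorphic slots have the same different exponent. [cite: Mochizuki2012, IUTchIV Prop. 1.1 p. 9] -/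
theorem differentOrd_eq_of_algEquiv_isometry {i₀ i : I} (τ : k i₀ ≃ₐ[ℚ_[p]] k i) :
    differentOrd p (k i) = differentOrd p (k i₀) :=
  (differentOrd_eq_of_isometry_of_surjective p (τ : k i₀ →ₐ[ℚ_[p]] k i)
    (fun x => norm_map_algHom (τ : k i₀ →ₐ[ℚ_[p]] k i) x) τ.surjective).symm

/-- **Packets of ONE normal field: the sharp different gain is `(|I| − 1)·d`.** With every `k_i ≅ k_{i₀}` normal over
`ℚ_p`: `d_I − min_J d_{L_J} = (|I| − 1)·d_{i₀}` — the term of `TensorPacketContentSharp.packetLogμ_packetHull_orbit_ge_sharp_inf`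
evaluated; against [IUTchIV] Prop. 1.1's `d_{I*} = (|I| − 1)·d` this says the lower end of the orbit-hull volume
sits exactly at Prop. 1.1's exponent. [cite: Mochizuki2012, IUTchIV Prop. 1.1 p. 9] -/
theorem dSum_sub_inf_differentOrd_dFac_eq_of_normal (i₀ : I) [Normal ℚ_[p] (k i₀)] (τ : ∀ i, k i₀ ≃ₐ[ℚ_[p]] k i) :
    dSum p k - (Finset.univ : Finset (DIdx p k)).inf' Finset.univ_nonempty
        (fun J => differentOrd p (DFac p k J)) =
      ((Fintype.card I : ℝ) - 1) * differentOrd p (k i₀) := by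
  have hinf : (Finset.univ : Finset (DIdx p k)).inf' Finset.univ_nonempty
      (fun J => differentOrd p (DFac p k J)) = differentOrd p (k i₀) := by
    obtain ⟨J, -, hJ⟩ := Finset.exists_mem_eq_inf' (Finset.univ_nonempty : (Finset.univ :
      Finset (DIdx p k)).Nonempty) (fun J => differentOrd p (DFac p k J))
    rw [hJ, differentOrd_dFac_eq_of_normal p k i₀ τ J]
  have hsum : dSum p k = (Fintype.card I : ℝ) * differentOrd p (k i₀) := by
    rw [dSum, Finset.sum_congr rfl (fun i _ => differentOrd_eq_of_algEquiv_isometry p k (τ i)),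
      Finset.sum_const, Finset.card_univ, nsmul_eq_mul]
  rw [hinf, hsum]
  ring

end Factors

end Literature.IUT.LogVolume

end
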